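import Summits.BirchSwinnertonDyer.BirchSwinnertonDyer.Theorems.AdditiveKolyvaginRoadRamifiedHabitatSignLawEvenAnyLevel
import Summits.BirchSwinnertonDyer.BirchSwinnertonDyer.Theorems.AdditiveKolyvaginRoadRamifiedHabitatSignLawIZeroStarAnyLevel
import HarnessLib

/-!
# Route `AdditiveKolyvaginRoad`, crux KS′ `LevelKolyvaginSystemsAdditive` (stmt-BirchSwinnertonDyer-21396), card `ramified-toric-habitat` —
# the card's FIRST LEMMA `SignLawSupercuspidal` IN THE SKETCH'S OWN BINDERS, ANY LEVEL, EVERY `d_{K′}` (no parity binder)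

Cell `pub/bsd-wall`, width seat `bsd-wall-akr-p2x-w3` g13; `--supports stmt-BirchSwinnertonDyer-21396` (helper). THEOREMS ONLY; no definition,
no named fact, no `sorry`. BSD is not proved by any of this; KS′/KPA′ stay OPEN at `p² ∣ N`.

w2 g12's `…SignLawAnyLevelSketch` / `…IZeroStarAnyLevel` prove the sketch's `RamifiedToricHabitat.SignLawSupercuspidal`
(`Cruxes/LevelKolyvaginSystemsAdditive/RamifiedHabitatKuriharaSlotSketch.lean` §1) and the potentially good principal-series companion with the
sketch's binders and NOTHING ELSE about `E` — for ODD `d_{K′}`. This seat's `…SignLawEven*` chain (even coprime twist law through the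
Kronecker character mod `|D'|`, Murty–Murty Ch. 6 §1) supplies EVEN `d_{K′}` at any level. Here the two are joined:

* §1 `rootNumber_mul_rootNumber_twist_discr_even_eq_one_of_addv_of_not_semistabilityDefectAt_dvd` /
  `…_even_eq_neg_one_of_addv_of_padicValRat_j_nonneg` — EVEN `d_{K′}`, binders `Addv W p`, `¬ e ∣ p − 1` / (`0 ≤ ord_p j`, `e ∣ p − 1`),
  `OtherBadPrimesSplit` spelled out; ANY level; `W` need not be globally minimal (the local type is read on the `ℤ_p`-minimal model:
  w3 g12's Serre formula `semistabilityDefectAt_eq_twelve_div_gcd_of_addVal_eq` and table `toNat_addVal_Δ_minimal_padic_mem_…`).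
* §2 **`signLawSupercuspidal_asTyped`** — `W` globally minimal, `p ≥ 5`, `Addv W p`, `¬ W.semistabilityDefectAt p ∣ p − 1`, `K′` imaginary
  quadratic, `p ∣ d_{K′}`, `OtherBadPrimesSplit W p d_{K′}` ⟹ `w(E)·w(E^{(d_{K′})}) = +1`: **the sketch's Prop with its binder list, for EVERY
  `E` and EVERY `K′`, modulo the named facts `hmod` (Modularity) and `hF1`, `hF1'` (Kellock–Dokchitser Rem. 2.2 at `p` for `E`, `E^{(p*)}`)**;
  the sketch's idle binders `1 < e`, `d_{K′} < −4` are not needed. **`signLawPrincipalSeries_asTyped_of_padicValRat_j_nonneg`** — the companion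
  on every potentially good additive row (`0 ≤ ord_p j`; FALSE without it on the potentially multiplicative rows, evidence #41 and
  `…ramifiedTwist_even_of_potMult_anyLevel`).

References: [cite: Serre1972, §5.6 (p. 312)] [cite: Rohrlich1993Compositio, Prop. 2(iv)] [cite: KellockDokchitser2023, Rem. 2.2]
[cite: MurtyMurty1997, Ch. 6 §1] [cite: SilvermanATAEC1994, IV.10.4].
-/

set_option autoImplicit false
set_option linter.dupNamespace false

noncomputable section

open scoped Classical NumberTheorySymbols

open IsDedekindDomain IsDedekindDomain.HeightOneSpectrum NumberField Rat.HeightOneSpectrum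
  WeierstrassCurve Literature.NumberTheory.EllipticCurves Literature.NumberTheory.EllipticCurves.Rank1Residual
  Literature.NumberTheory.EllipticCurves.ModularForms Literature.NumberTheory.DiophantineGeometry
  IsDiscreteValuationRing

namespace Summit.BirchSwinnertonDyer.BirchSwinnertonDyer.Theorems.AdditiveKoly.RamifiedHabitat

section AsTypedAnyLevel

variable {p : ℕ} [Fact p.Prime]

omit [Fact p.Prime] in
/-- `OtherBadPrimesSplit W p d` read on `N = M·p²`, `p ∤ M`: the primes of `M` split (and `d ≡ 1 (8)` if `2 ∣ M`). [folklore] -/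
private theorem split_data_of_otherBadPrimesSplit_anyLevel (W : WeierstrassCurve ℚ) [W.IsElliptic] {M : ℕ}
    (hN : W.conductorNorm ℤ = M * p ^ 2) (hpM : ¬ p ∣ M) {d : ℤ}
    (hsplit : ∀ q : ℕ, q.Prime → (q : ℤ) ∣ (W.conductorNorm ℤ : ℤ) → q ≠ p →
      (q ≠ 2 → J(d | q) = 1) ∧ (q = 2 → d % 8 = 1)) :
    (∀ q ∈ M.primeFactors, q ≠ 2 → J(d | q) = 1) ∧ (2 ∣ M → d % 8 = 1) := by
  have hdvdN : ∀ q : ℕ, q ∣ M → (q : ℤ) ∣ (W.conductorNorm ℤ : ℤ) := fun q hq ↦ by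
    rw [hN]; exact_mod_cast dvd_mul_of_dvd_left hq (p ^ 2)
  have hne : ∀ q : ℕ, q ∣ M → q ≠ p := fun q hq h ↦ hpM (h ▸ hq)
  refine ⟨fun q hq hq2 ↦ ?_, fun h2M ↦ ?_⟩
  · exact (hsplit q (Nat.prime_of_mem_primeFactors hq) (hdvdN q (Nat.dvd_of_mem_primeFactors hq))
      (hne q (Nat.dvd_of_mem_primeFactors hq))).1 hq2
  · exact (hsplit 2 Nat.prime_two (hdvdN 2 h2M) (hne 2 h2M)).2 rfl

/-- The exponent `a = ord Δ(X)` of the `ℤ_p`-minimal model at an additive potentially good `p ≥ 5` lies in Serre's table `{2,3,4,6,8,9,10}`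
(w3 g12's `toNat_addVal_Δ_minimal_padic_mem_of_hasAdditiveReduction`, packaged). [folklore] -/
private theorem addVal_data_of_addv' (W : WeierstrassCurve ℚ) [W.IsElliptic] (hp5 : 5 ≤ p) (hadd : Addv W p)
    (hjQ : 0 ≤ padicValRat p W.j) :
    ∃ a : ℕ, addVal ℤ_[p] (((W.baseChange ℚ_[p]).minimal ℤ_[p]).integralModel ℤ_[p]).Δ = a ∧
      (a = 2 ∨ a = 3 ∨ a = 4 ∨ a = 6 ∨ a = 8 ∨ a = 9 ∨ a = 10) ∧
      addVal ℤ_[p] (((W.baseChange ℚ_[p]).minimal ℤ_[p]).integralModel ℤ_[p]).c₄ ≠ 0 ∧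
      ¬ 3 * addVal ℤ_[p] (((W.baseChange ℚ_[p]).minimal ℤ_[p]).integralModel ℤ_[p]).c₄ <
        addVal ℤ_[p] (((W.baseChange ℚ_[p]).minimal ℤ_[p]).integralModel ℤ_[p]).Δ := by
  have haddX := W.hasAdditiveReduction_minimal_padic_of_not_good_of_not_mult hadd.1 hadd.2
  obtain ⟨hc₄, -⟩ := W.addVal_ne_zero_of_hasAdditiveReduction_minimal_padic haddX
  have hj := (W.padicValRat_j_nonneg_iff_not_addVal_lt).mp hjQ
  set a : ℕ := (addVal ℤ_[p] (((W.baseChange ℚ_[p]).minimal ℤ_[p]).integralModel ℤ_[p]).Δ).toNat with ha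
  have hmem := W.toNat_addVal_Δ_minimal_padic_mem_of_hasAdditiveReduction hp5 haddX hj
  have htop : addVal ℤ_[p] (((W.baseChange ℚ_[p]).minimal ℤ_[p]).integralModel ℤ_[p]).Δ ≠ ⊤ := by
    intro h
    rw [h] at hmem
    simp at hmem
  have hΔ : addVal ℤ_[p] (((W.baseChange ℚ_[p]).minimal ℤ_[p]).integralModel ℤ_[p]).Δ = a := by
    rw [ha, ENat.coe_toNat htop]
  rw [← ha] at hmem
  exact ⟨a, hΔ, hmem, hc₄, hj⟩

/-! ## §1 Even `d_{K′}`, the sketch's binders, any level -/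

/-- **`SignLawSupercuspidal` FOR EVEN `d_{K′}`, IN THE SKETCH'S BINDERS, ANY LEVEL.** `W/ℚ` elliptic (any model), `p ≥ 5` ADDITIVE
(`Addv W p`) with `¬ W.semistabilityDefectAt p ∣ p − 1`, `K′` imaginary quadratic with `4 ∣ d_{K′}`, `p ∣ d_{K′}`, every other bad prime split
(`OtherBadPrimesSplit W p d_{K′}` spelled out). Then `w(E)·w(E^{(d_{K′})}) = +1`, for `E` with ARBITRARY reduction off `p`. Chain: `f_p = 2`
⟹ `N = M p²`, `p ∤ M` (`conductorNorm_eq_div_mul_sq_of_addv`); `¬ e ∣ p − 1` ⟹ `0 ≤ ord_p j` (`padicValRat_j_nonneg_of_not_semistabilityDefectAt_dvd`),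
`a := ord_pΔ(X) ∈ {2,3,4,8,9,10}` (Serre; `a = 6` has `e = 2`); then `…twist_discr_even_anyLevel_eq_one_of_not_dvd`. CONDITIONAL on {hmod, F1 at `p`}.
BSD is not proved by this. [cite: Serre1972, §5.6 (p. 312)] [cite: Rohrlich1993Compositio, Prop. 2(iv)] [cite: KellockDokchitser2023, Rem. 2.2]
[cite: SilvermanATAEC1994, IV.10.4] -/
theorem rootNumber_mul_rootNumber_twist_discr_even_eq_one_of_addv_of_not_semistabilityDefectAt_dvd
    (W : WeierstrassCurve ℚ) [W.IsElliptic]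
    (hmod : exists_isNewformOf) (hF1 : W.atkinLehnerEigenvalueAt_eq_localRootNumberAt)
    (hF1' : (W.quadraticTwist (((-1 : ℤ) ^ (p / 2) * p : ℤ) : ℚ)).atkinLehnerEigenvalueAt_eq_localRootNumberAt)
    (hp5 : 5 ≤ p) (hadd : Addv W p) (hsc : ¬ W.semistabilityDefectAt p ∣ p - 1)
    (K : Type) [Field K] [NumberField K] (hK : IsImaginaryQuadratic K) (h4K : 4 ∣ NumberField.discr K)
    (hpd : (p : ℤ) ∣ NumberField.discr K)
    (hsplit : ∀ q : ℕ, q.Prime → (q : ℤ) ∣ (W.conductorNorm ℤ : ℤ) → q ≠ p →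
      (q ≠ 2 → J(NumberField.discr K | q) = 1) ∧ (q = 2 → NumberField.discr K % 8 = 1)) :
    W.rootNumber * (W.quadraticTwist (NumberField.discr K : ℚ)).rootNumber = 1 := by
  have hp : p.Prime := Fact.out
  obtain ⟨hN, hpM⟩ := conductorNorm_eq_div_mul_sq_of_addv W hp5 hadd
  have hjQ : 0 ≤ padicValRat p W.j :=
    W.padicValRat_j_nonneg_of_not_semistabilityDefectAt_dvd hp5 hadd.1 hadd.2 hsc
  obtain ⟨a, hΔ, hmem, hc₄, hj⟩ := addVal_data_of_addv' W hp5 hadd hjQ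
  obtain ⟨hodd, htwo⟩ := split_data_of_otherBadPrimesSplit_anyLevel W hN hpM hsplit
  rw [W.semistabilityDefectAt_eq_twelve_div_gcd_of_addVal_eq hp5 hΔ hj] at hsc
  have hne6 : a ≠ 6 := by
    intro h6
    apply hsc
    rw [h6, show 12 / Nat.gcd 6 12 = 2 by decide]
    rcases hp.eq_two_or_odd with h | h <;> omega
  have ha' : a = 2 ∨ a = 3 ∨ a = 4 ∨ a = 8 ∨ a = 9 ∨ a = 10 := by
    rcases hmem with h | h | h | h | h | h | h
    · exact Or.inl h
    · exact Or.inr (Or.inl h)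
    · exact Or.inr (Or.inr (Or.inl h))
    · exact absurd h hne6
    · exact Or.inr (Or.inr (Or.inr (Or.inl h)))
    · exact Or.inr (Or.inr (Or.inr (Or.inr (Or.inl h))))
    · exact Or.inr (Or.inr (Or.inr (Or.inr (Or.inr h))))
  exact rootNumber_mul_rootNumber_twist_discr_even_anyLevel_eq_one_of_not_dvd W hmod hF1 hF1' hp5 hN hpM hΔ ha' hc₄ hj K hK h4K
    hpd hodd htwo hsc

/-- **PRINCIPAL-SERIES companion FOR EVEN `d_{K′}`, IN THE SKETCH'S BINDERS, ANY LEVEL, every potentially good additive row** (`0 ≤ ord_p j` —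
the binder the sketch's `SignLawPrincipalSeries` lacks; type I₀* by `…twist_discr_even_of_six_anyLevel`, Modularity only; the six other types by
`…_eq_neg_one_of_dvd`): `w(E)·w(E^{(d_{K′})}) = −1`. CONDITIONAL on {hmod, F1 at `p`}; BSD is not proved by this.
[cite: Serre1972, §5.6 (p. 312)] [cite: Rohrlich1993Compositio, Prop. 2(iv)] [cite: KellockDokchitser2023, Rem. 2.2] -/
theorem rootNumber_mul_rootNumber_twist_discr_even_eq_neg_one_of_addv_of_padicValRat_j_nonneg
    (W : WeierstrassCurve ℚ) [W.IsElliptic]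
    (hmod : exists_isNewformOf) (hF1 : W.atkinLehnerEigenvalueAt_eq_localRootNumberAt)
    (hF1' : (W.quadraticTwist (((-1 : ℤ) ^ (p / 2) * p : ℤ) : ℚ)).atkinLehnerEigenvalueAt_eq_localRootNumberAt)
    (hp5 : 5 ≤ p) (hadd : Addv W p) (hjQ : 0 ≤ padicValRat p W.j) (hps : W.semistabilityDefectAt p ∣ p - 1)
    (K : Type) [Field K] [NumberField K] (hK : IsImaginaryQuadratic K) (h4K : 4 ∣ NumberField.discr K)
    (hpd : (p : ℤ) ∣ NumberField.discr K)
    (hsplit : ∀ q : ℕ, q.Prime → (q : ℤ) ∣ (W.conductorNorm ℤ : ℤ) → q ≠ p →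
      (q ≠ 2 → J(NumberField.discr K | q) = 1) ∧ (q = 2 → NumberField.discr K % 8 = 1)) :
    W.rootNumber * (W.quadraticTwist (NumberField.discr K : ℚ)).rootNumber = -1 := by
  obtain ⟨hN, hpM⟩ := conductorNorm_eq_div_mul_sq_of_addv W hp5 hadd
  obtain ⟨a, hΔ, hmem, hc₄, hj⟩ := addVal_data_of_addv' W hp5 hadd hjQ
  obtain ⟨hodd, htwo⟩ := split_data_of_otherBadPrimesSplit_anyLevel W hN hpM hsplit
  by_cases h6 : a = 6
  · rw [h6] at hΔ
    exact rootNumber_mul_rootNumber_twist_discr_even_of_six_anyLevel W hmod hp5 hN hpM hΔ hc₄ hj K hK h4K hpd hodd htwo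
  · rw [W.semistabilityDefectAt_eq_twelve_div_gcd_of_addVal_eq hp5 hΔ hj] at hps
    have ha' : a = 2 ∨ a = 3 ∨ a = 4 ∨ a = 8 ∨ a = 9 ∨ a = 10 := by
      rcases hmem with h | h | h | h | h | h | h
      · exact Or.inl h
      · exact Or.inr (Or.inl h)
      · exact Or.inr (Or.inr (Or.inl h))
      · exact absurd h h6
      · exact Or.inr (Or.inr (Or.inr (Or.inl h)))
      · exact Or.inr (Or.inr (Or.inr (Or.inr (Or.inl h))))
      · exact Or.inr (Or.inr (Or.inr (Or.inr (Or.inr h))))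
    exact rootNumber_mul_rootNumber_twist_discr_even_anyLevel_eq_neg_one_of_dvd W hmod hF1 hF1' hp5 hN hpM hΔ ha' hc₄ hj K hK h4K
      hpd hodd htwo hps

/-! ## §2 Every `d_{K′}`: the sketch's Props AS TYPED, any level -/

/-- **THE CARD'S FIRST LEMMA `SignLawSupercuspidal` AS TYPED — ANY LEVEL, EVERY `d_{K′}`.** Binders of the sketch's
`RamifiedToricHabitat.SignLawSupercuspidal` (`RamifiedHabitatKuriharaSlotSketch.lean` §1): `W/ℚ` a global minimal model of an elliptic curve,
`p ≥ 5`, `Addv W p`, `¬ W.semistabilityDefectAt p ∣ p − 1` (non-abelian inertia: supercuspidal local type), `K′` imaginary quadratic,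
`p ∣ d_{K′}`, `OtherBadPrimesSplit W p d_{K′}` (spelled out verbatim); PLUS the named facts `hmod` (Modularity, `exists_isNewformOf`) and
`hF1`, `hF1'` (Kellock–Dokchitser Rem. 2.2 at `p` for `W`, `W^{(p*)}`, `atkinLehnerEigenvalueAt_eq_localRootNumberAt`). CONCLUSION:
`w(E)·w(E^{(d_{K′})}) = +1` — the sign of `E/K′` is `+1` WHATEVER `w(E)` is (the definite algebra `B_{p∞}` is the habitat). The sketch's idle
binders `1 < e` and `d_{K′} < −4` are not needed; NO restriction on the level or on the parity of `d_{K′}` remains. Odd `d_{K′}`: w2 g12's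
`rootNumber_mul_rootNumber_twist_discr_eq_one_of_addv_of_not_semistabilityDefectAt_dvd`; `4 ∣ d_{K′}`: §1 (a quadratic discriminant is one or
the other, `Quadratic.isFundamentalDiscriminant_discr`). BSD is not proved by this; KS′/KPA′ stay OPEN at `p² ∣ N`.
[cite: Serre1972, §5.6 (p. 312)] [cite: Rohrlich1993Compositio, Prop. 2(iv)] [cite: KellockDokchitser2023, Rem. 2.2] [cite: MurtyMurty1997, Ch. 6 §1] -/
theorem signLawSupercuspidal_asTyped (W : WeierstrassCurve ℚ) [W.IsElliptic] [W.IsGloballyMinimal]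
    (hmod : exists_isNewformOf) (hF1 : W.atkinLehnerEigenvalueAt_eq_localRootNumberAt)
    (hF1' : (W.quadraticTwist (((-1 : ℤ) ^ (p / 2) * p : ℤ) : ℚ)).atkinLehnerEigenvalueAt_eq_localRootNumberAt)
    (hp5 : 5 ≤ p) (hadd : Addv W p) (hsc : ¬ W.semistabilityDefectAt p ∣ p - 1)
    (K : Type) [Field K] [NumberField K] (hK : IsImaginaryQuadratic K) (hpd : (p : ℤ) ∣ NumberField.discr K)
    (hsplit : ∀ q : ℕ, q.Prime → (q : ℤ) ∣ (W.conductorNorm ℤ : ℤ) → q ≠ p →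
      (q ≠ 2 → J(NumberField.discr K | q) = 1) ∧ (q = 2 → NumberField.discr K % 8 = 1)) :
    W.rootNumber * (W.quadraticTwist (NumberField.discr K : ℚ)).rootNumber = 1 := by
  rcases Literature.NumberTheory.QuadraticFields.Quadratic.isFundamentalDiscriminant_discr (K := K) hK.1 with
    ⟨h1, -, -⟩ | ⟨h4, -, -⟩
  · exact rootNumber_mul_rootNumber_twist_discr_eq_one_of_addv_of_not_semistabilityDefectAt_dvd W hmod hF1 hF1' hp5 hadd hsc K hK
      (Int.odd_iff.mpr (by omega)) hpd hsplit
  · exact rootNumber_mul_rootNumber_twist_discr_even_eq_one_of_addv_of_not_semistabilityDefectAt_dvd W hmod hF1 hF1' hp5 hadd hsc K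
      hK h4 hpd hsplit

/-- **`SignLawPrincipalSeries` AS TYPED on EVERY POTENTIALLY GOOD ADDITIVE ROW — ANY LEVEL, EVERY `d_{K′}`.** The sketch's binders (`W` global
minimal, `p ≥ 5`, `Addv W p`, `W.semistabilityDefectAt p ∣ p − 1`, `K′` imaginary quadratic, `p ∣ d_{K′}`, `OtherBadPrimesSplit`) PLUS
`0 ≤ ord_p j` (potentially good — the sketch's Prop lacks it and is FALSE on the potentially multiplicative rows, where the sign flips with the
habitat: evidence #41, `…ramifiedTwist_of_potMult_anyLevel`, `…ramifiedTwist_even_of_potMult_anyLevel`) and the named facts {`hmod`, `hF1`, `hF1'`}.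
CONCLUSION `w(E)·w(E^{(d_{K′})}) = −1`: the analytic-rank-one rows of such a frame never have the definite habitat. BSD is not proved by this.
[cite: Serre1972, §5.6 (p. 312)] [cite: Rohrlich1993Compositio, Prop. 2(iv)] [cite: KellockDokchitser2023, Rem. 2.2] [cite: MurtyMurty1997, Ch. 6 §1] -/
theorem signLawPrincipalSeries_asTyped_of_padicValRat_j_nonneg (W : WeierstrassCurve ℚ) [W.IsElliptic] [W.IsGloballyMinimal]
    (hmod : exists_isNewformOf) (hF1 : W.atkinLehnerEigenvalueAt_eq_localRootNumberAt)
    (hF1' : (W.quadraticTwist (((-1 : ℤ) ^ (p / 2) * p : ℤ) : ℚ)).atkinLehnerEigenvalueAt_eq_localRootNumberAt)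
    (hp5 : 5 ≤ p) (hadd : Addv W p) (hjQ : 0 ≤ padicValRat p W.j) (hps : W.semistabilityDefectAt p ∣ p - 1)
    (K : Type) [Field K] [NumberField K] (hK : IsImaginaryQuadratic K) (hpd : (p : ℤ) ∣ NumberField.discr K)
    (hsplit : ∀ q : ℕ, q.Prime → (q : ℤ) ∣ (W.conductorNorm ℤ : ℤ) → q ≠ p →
      (q ≠ 2 → J(NumberField.discr K | q) = 1) ∧ (q = 2 → NumberField.discr K % 8 = 1)) :
    W.rootNumber * (W.quadraticTwist (NumberField.discr K : ℚ)).rootNumber = -1 := by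
  rcases Literature.NumberTheory.QuadraticFields.Quadratic.isFundamentalDiscriminant_discr (K := K) hK.1 with
    ⟨h1, -, -⟩ | ⟨h4, -, -⟩
  · exact rootNumber_mul_rootNumber_twist_discr_eq_neg_one_of_addv_of_padicValRat_j_nonneg W hmod hF1 hF1' hp5 hadd hjQ hps K hK
      (Int.odd_iff.mpr (by omega)) hpd hsplit
  · exact rootNumber_mul_rootNumber_twist_discr_even_eq_neg_one_of_addv_of_padicValRat_j_nonneg W hmod hF1 hF1' hp5 hadd hjQ hps K
      hK h4 hpd hsplit

end AsTypedAnyLevel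

end Summit.BirchSwinnertonDyer.BirchSwinnertonDyer.Theorems.AdditiveKoly.RamifiedHabitat

end
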